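import Summits.CriticalPhenomena.PercolationContinuityZ3.Theorems.Transplant.SkelPhiCorridorKGBoxes
import HarnessLib

/-!
# N2 (frames-only node `SamePDropOfSkeletonFrm₁`, OPEN), (R) column second axis: **THE SECOND-AXIS K-G CORRIDOR VALUES ARE MONOTONE IN THE
# WINDOW SLOTS `(q, W)`**, and the across centre / spread / box extents of two corridors with different windows differ by a closed form
# (integers only; the two `kgCtr2Y` bounds hold for ANY two windows) — `Skelφ.kgT₁Y_monoW / KGYRows.kgM₁Y_monoW / KGYRows.kgM₁Y_sub_mul_le / KGYRows.kgTY_mono_qW / KGYRows.kgM₂Y_mono_qW /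
# KGYRows.kgXY_mono_qW / KGYRows.kgFarY_mono_qW / KGYRows.kgSchedLenY_mono_qW / KGYRows.kgHw2Y_le_of_le_qW / KGYRows.kgCtr2Y_sub_le /
# KGYRows.le_kgCtr2Y_sub / KGYRows.kgZY₀_le_of_le_qW / KGYRows.kgZY₁_mono_qW`.
Why ((R-46), lane INBOX 2026-08-23T12:17:36Z p3-g17): the ROOT's y′-corridor runs at stmt's along window and run length `(q_Y, kgNYv0)` but at its OWN,
smaller across window `W^R = W_Y − X2R` from an origin `X2R` east of the terminal (seed clearance), so that its core-0 east edge — and with it the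
forward-parked arrival — coincides with (C)'s; the lemmas here bound every root value by the (C) value at the larger window: `farY^R ≤ farY^C` (so
`kgNYv0` fits), `kgCtr2Y^C − kgCtr2Y^R ∈ 2(W_Y − W^R) + 2Δm₁·(R′+ρ) ± (dec₁Y − 1)` (creep matching), `kgHw2Y^R ≤ kgHw2Y^C + dec₁Y − 1`, `ZY₀^R ≤
ZY₀^C + dec₁Y − 1`, `ZY₁^R ≤ ZY₁^C`, schedule length `≤`.  Cell-free and window-generic (no ledger names).
builds on p205010 (kernel theorem, internal audit signed; external expert review pending) — nothing in this file uses p205010; nothing here is a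
claim about the open node `SamePDropOfSkeletonFrm₁`.
Lane `prim-bschramm`, seat `prim-bschramm-p3` (gen 17; (R) lineage); helper file (`--supports stmt-CriticalPhenomena-4575 --as helper`).
[cite: KozmaNitzan2024, §4 Lemma 12 (pp. 23–25: the target box of a corridor)] [cite: MartineauTassion2017, §4.3 Lemma 4.2 (steering)]
-/

namespace Summit.CriticalPhenomena.PercolationContinuityZ3.Theorems.Transplant

namespace Skelφ

open Literature.Probability.Percolation Literature.Probability.LatticeModels SimpleGraph
open ChainPlanar ChainPara

section KGYMonoW

variable {n ℓ : ℕ} {hs v : ℤ} {R' ρ q W q' W' : ℕ}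

/-- `T₁Y = 2W + 2(N+1)R′ − 2|v|` is monotone in the window `W`. [this work] -/
theorem kgT₁Y_monoW (v : ℤ) (R' : ℕ) {W W' : ℕ} (hW : W ≤ W') (N : ℕ) : kgT₁Y v R' W N ≤ kgT₁Y v R' W' N := by
  unfold kgT₁Y
  have : (W : ℤ) ≤ W' := by exact_mod_cast hW
  linarith

/-- **`m₁Y` is monotone in `W`.** [this work] -/
theorem KGYRows.kgM₁Y_monoW (H : KGYRows n ℓ hs v R' ρ q W) {W' : ℕ} (hW : W ≤ W') (N : ℕ) :
    kgM₁Y n v R' ρ W N ≤ kgM₁Y n v R' ρ W' N := by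
  have hd : 0 < kgDec₁Y n R' ρ := by
    have := H.dec₁_pos.1; have : (0 : ℤ) ≤ R' := by positivity
    have : (0 : ℤ) ≤ ρ := by positivity
    linarith
  unfold kgM₁Y
  exact Nat.sub_le_sub_right (Int.toNat_le_toNat (Int.ediv_le_ediv hd (kgT₁Y_monoW v R' hW N))) 1

/-- **The growth of `m₁Y` with the window is at most linear**: `dec₁Y·(m₁Y(W′) − m₁Y(W)) ≤ 2(W′ − W) + dec₁Y − 1` (both `m₁Y + 1` are floors of
`T₁Y/dec₁Y`, `T₁Y(W′) − T₁Y(W) = 2(W′ − W)`). [this work] -/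
theorem KGYRows.kgM₁Y_sub_mul_le (H : KGYRows n ℓ hs v R' ρ q W) (H' : KGYRows n ℓ hs v R' ρ q' W') (N : ℕ) :
    kgDec₁Y n R' ρ * (((kgM₁Y n v R' ρ W' N : ℕ) : ℤ) - (kgM₁Y n v R' ρ W N : ℕ)) ≤ 2 * ((W' : ℤ) - W) + kgDec₁Y n R' ρ - 1 := by
  have hd : 0 < kgDec₁Y n R' ρ := by
    have := H.dec₁_pos.1; have : (0 : ℤ) ≤ R' := by positivity
    have : (0 : ℤ) ≤ ρ := by positivity
    linarith
  obtain ⟨he, -⟩ := H.kgM₁Y_spec N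
  obtain ⟨he', -⟩ := H'.kgM₁Y_spec N
  have h1 := Int.ediv_mul_le (kgT₁Y v R' W' N) (ne_of_gt hd)
  have h2 := Int.lt_ediv_add_one_mul_self (kgT₁Y v R' W N) hd
  rw [← he'] at h1
  rw [← he] at h2
  have eT : kgT₁Y v R' W' N - kgT₁Y v R' W N = 2 * ((W' : ℤ) - W) := by unfold kgT₁Y; ring
  have h3 : kgDec₁Y n R' ρ * (((kgM₁Y n v R' ρ W' N : ℕ) : ℤ) - (kgM₁Y n v R' ρ W N : ℕ)) <
      2 * ((W' : ℤ) - W) + kgDec₁Y n R' ρ := by nlinarith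
  linarith

/-- **`TY` is monotone in `(q, W)`.** [this work] -/
theorem KGYRows.kgTY_mono_qW (H : KGYRows n ℓ hs v R' ρ q W) (hq : q ≤ q') (hW : W ≤ W') (N : ℕ) :
    kgTY n ℓ hs v R' ρ q W N ≤ kgTY n ℓ hs v R' ρ q' W' N := by
  have hm : ((kgM₁Y n v R' ρ W N : ℕ) : ℤ) ≤ (kgM₁Y n v R' ρ W' N : ℕ) := by exact_mod_cast H.kgM₁Y_monoW hW N
  unfold kgTY
  have hq' : (q : ℤ) ≤ q' := by exact_mod_cast hq
  have hR : (0 : ℤ) ≤ R' := by positivity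
  have hρ : (0 : ℤ) ≤ ρ := by positivity
  nlinarith

/-- **`m₂Y` is monotone in `(q, W)`.** [this work] -/
theorem KGYRows.kgM₂Y_mono_qW (H : KGYRows n ℓ hs v R' ρ q W) (hq : q ≤ q') (hW : W ≤ W') (N : ℕ) :
    kgM₂Y n ℓ hs v R' ρ q W N ≤ kgM₂Y n ℓ hs v R' ρ q' W' N := by
  have hd : 0 < kgDec₂Y n ℓ hs R' ρ := by
    have := H.dec₂_pos; have : (0 : ℤ) ≤ R' := by positivity
    have : (0 : ℤ) ≤ ρ := by positivity
    linarith
  unfold kgM₂Y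
  have hT := H.kgTY_mono_qW hq hW N
  have hdiv : (kgTY n ℓ hs v R' ρ q W N - ((n : ℤ) * ℓ / (shearUnit n hs : ℕ) + 1 + ρ - 1) + kgDec₂Y n ℓ hs R' ρ - 1) / kgDec₂Y n ℓ hs R' ρ ≤
      (kgTY n ℓ hs v R' ρ q' W' N - ((n : ℤ) * ℓ / (shearUnit n hs : ℕ) + 1 + ρ - 1) + kgDec₂Y n ℓ hs R' ρ - 1) / kgDec₂Y n ℓ hs R' ρ :=
    Int.ediv_le_ediv hd (by linarith)
  exact Nat.sub_le_sub_right (Int.toNat_le_toNat (max_le_max le_rfl hdiv)) 1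

/-- **`XY` is monotone in `(q, W)`.** [this work] -/
theorem KGYRows.kgXY_mono_qW (H : KGYRows n ℓ hs v R' ρ q W) (hq : q ≤ q') (hW : W ≤ W') (N : ℕ) :
    kgXY n ℓ hs v R' ρ q W N ≤ kgXY n ℓ hs v R' ρ q' W' N := by
  have hm₁ : ((kgM₁Y n v R' ρ W N : ℕ) : ℤ) ≤ (kgM₁Y n v R' ρ W' N : ℕ) := by exact_mod_cast H.kgM₁Y_monoW hW N
  have hm₂ : ((kgM₂Y n ℓ hs v R' ρ q W N : ℕ) : ℤ) ≤ (kgM₂Y n ℓ hs v R' ρ q' W' N : ℕ) := by exact_mod_cast H.kgM₂Y_mono_qW hq hW N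
  unfold kgXY
  have hq' : (q : ℤ) ≤ q' := by exact_mod_cast hq
  have hR : (0 : ℤ) ≤ R' := by positivity
  have hρ : (0 : ℤ) ≤ ρ := by positivity
  nlinarith

/-- **The arrival's far edge is monotone in `(q, W)`** (so a run length that fits at the larger window fits at the smaller). [this work] -/
theorem KGYRows.kgFarY_mono_qW (H : KGYRows n ℓ hs v R' ρ q W) (hq : q ≤ q') (hW : W ≤ W') (N : ℕ) :
    kgFarY n ℓ hs v R' ρ q W N ≤ kgFarY n ℓ hs v R' ρ q' W' N := by
  have := H.kgXY_mono_qW hq hW N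
  unfold kgFarY; linarith

/-- **The schedule length is monotone in `(q, W)`.** [this work] -/
theorem KGYRows.kgSchedLenY_mono_qW (H : KGYRows n ℓ hs v R' ρ q W) (hq : q ≤ q') (hW : W ≤ W') (N : ℕ) :
    N + 1 + (kgM₁Y n v R' ρ W N + 1) + (kgM₂Y n ℓ hs v R' ρ q W N + 1) ≤
      N + 1 + (kgM₁Y n v R' ρ W' N + 1) + (kgM₂Y n ℓ hs v R' ρ q' W' N + 1) := by
  have := H.kgM₁Y_monoW hW N
  have := H.kgM₂Y_mono_qW hq hW N
  omega

/-- **Twice the arrival's across half-width at the smaller window is at most its value at the larger window plus `dec₁Y − 1`** (`E₁Y` is not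
monotone, but both lie in `[2(n+|v|), 2(n+|v|) + dec₁Y)`; `m₂Y` is monotone). [this work] -/
theorem KGYRows.kgHw2Y_le_of_le_qW (H : KGYRows n ℓ hs v R' ρ q W) (H' : KGYRows n ℓ hs v R' ρ q' W') (hq : q ≤ q') (hW : W ≤ W') (N : ℕ) :
    kgHw2Y n ℓ hs v R' ρ q W N ≤ kgHw2Y n ℓ hs v R' ρ q' W' N + kgDec₁Y n R' ρ - 1 := by
  obtain ⟨-, -, hE⟩ := H.kgE₁Y_spec N
  obtain ⟨-, hE', -⟩ := H'.kgE₁Y_spec N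
  have hm₂ : ((kgM₂Y n ℓ hs v R' ρ q W N : ℕ) : ℤ) ≤ (kgM₂Y n ℓ hs v R' ρ q' W' N : ℕ) := by exact_mod_cast H.kgM₂Y_mono_qW hq hW N
  unfold kgHw2Y
  have hR : (0 : ℤ) ≤ R' := by positivity
  have hρ : (0 : ℤ) ≤ ρ := by positivity
  have hv : (0 : ℤ) ≤ |v| := abs_nonneg _
  nlinarith

/-- **CREEP MATCHING, upper side**: `kgCtr2Y(W′) − kgCtr2Y(W) ≤ 2(W′ − W) + 2(m₁Y(W′) − m₁Y(W))(R′+ρ) + dec₁Y − 1` (`A₁Yp(W′) − A₁Yp(W) = W′ − W`,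
`|E₁Y(W′) − E₁Y(W)| < dec₁Y`). [this work] -/
theorem KGYRows.kgCtr2Y_sub_le (H : KGYRows n ℓ hs v R' ρ q W) (H' : KGYRows n ℓ hs v R' ρ q' W') (N : ℕ) :
    kgCtr2Y n v R' ρ W' N - kgCtr2Y n v R' ρ W N ≤
      2 * ((W' : ℤ) - W) + 2 * ((((kgM₁Y n v R' ρ W' N : ℕ) : ℤ)) - (kgM₁Y n v R' ρ W N : ℕ)) * ((R' : ℤ) + ρ) + kgDec₁Y n R' ρ - 1 := by
  obtain ⟨-, -, hE⟩ := H.kgE₁Y_spec N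
  obtain ⟨-, hE', -⟩ := H'.kgE₁Y_spec N
  have eA : ((kgA₁Yp n v R' W' N : ℕ) : ℤ) - (kgA₁Yp n v R' W N : ℕ) = (W' : ℤ) - W := by
    unfold kgA₁Yp; push_cast; ring
  unfold kgCtr2Y
  linarith

/-- **CREEP MATCHING, lower side**: `2(W′ − W) + 2(m₁Y(W′) − m₁Y(W))(R′+ρ) − (dec₁Y − 1) ≤ kgCtr2Y(W′) − kgCtr2Y(W)`. [this work] -/
theorem KGYRows.le_kgCtr2Y_sub (H : KGYRows n ℓ hs v R' ρ q W) (H' : KGYRows n ℓ hs v R' ρ q' W') (N : ℕ) :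
    2 * ((W' : ℤ) - W) + 2 * ((((kgM₁Y n v R' ρ W' N : ℕ) : ℤ)) - (kgM₁Y n v R' ρ W N : ℕ)) * ((R' : ℤ) + ρ) - (kgDec₁Y n R' ρ - 1) ≤
      kgCtr2Y n v R' ρ W' N - kgCtr2Y n v R' ρ W N := by
  obtain ⟨-, hE, -⟩ := H.kgE₁Y_spec N
  obtain ⟨-, -, hE'⟩ := H'.kgE₁Y_spec N
  have eA : ((kgA₁Yp n v R' W' N : ℕ) : ℤ) - (kgA₁Yp n v R' W N : ℕ) = (W' : ℤ) - W := by
    unfold kgA₁Yp; push_cast; ring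
  unfold kgCtr2Y
  linarith

/-- **The across box extent `ZY₀` at the smaller window is at most its value at the larger window plus `dec₁Y − 1`.** [this work] -/
theorem KGYRows.kgZY₀_le_of_le_qW (H : KGYRows n ℓ hs v R' ρ q W) (H' : KGYRows n ℓ hs v R' ρ q' W') (hq : q ≤ q') (hW : W ≤ W') (N : ℕ) :
    kgZY₀ n v R' ρ W N (kgM₁Y n v R' ρ W N) (kgWm₂Y n v R' ρ W N) (kgWp₂Y n v R' ρ W N) (kgM₂Y n ℓ hs v R' ρ q W N) ≤
      kgZY₀ n v R' ρ W' N (kgM₁Y n v R' ρ W' N) (kgWm₂Y n v R' ρ W' N) (kgWp₂Y n v R' ρ W' N) (kgM₂Y n ℓ hs v R' ρ q' W' N) +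
        kgDec₁Y n R' ρ - 1 := by
  obtain ⟨-, -, hE⟩ := H.kgE₁Y_spec N
  obtain ⟨-, hE', -⟩ := H'.kgE₁Y_spec N
  have hsum : ((kgWm₂Y n v R' ρ W N : ℕ) : ℤ) + (kgWp₂Y n v R' ρ W N : ℕ) = (kgE₁Y n v R' ρ W N : ℕ) := by
    exact_mod_cast kgWm₂Y_add_kgWp₂Y (n := n) (v := v) (R' := R') (ρ := ρ) (W := W) N
  have hsum' : ((kgWm₂Y n v R' ρ W' N : ℕ) : ℤ) + (kgWp₂Y n v R' ρ W' N : ℕ) = (kgE₁Y n v R' ρ W' N : ℕ) := by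
    exact_mod_cast kgWm₂Y_add_kgWp₂Y (n := n) (v := v) (R' := R') (ρ := ρ) (W := W') N
  have hm₁ : ((kgM₁Y n v R' ρ W N : ℕ) : ℤ) ≤ (kgM₁Y n v R' ρ W' N : ℕ) := by exact_mod_cast H.kgM₁Y_monoW hW N
  have hm₂ : ((kgM₂Y n ℓ hs v R' ρ q W N : ℕ) : ℤ) ≤ (kgM₂Y n ℓ hs v R' ρ q' W' N : ℕ) := by exact_mod_cast H.kgM₂Y_mono_qW hq hW N
  unfold kgZY₀
  have hW' : (W : ℤ) ≤ W' := by exact_mod_cast hW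
  have hR : (0 : ℤ) ≤ R' := by positivity
  have hρ : (0 : ℤ) ≤ ρ := by positivity
  have hv : (0 : ℤ) ≤ |v| := abs_nonneg _
  nlinarith

/-- **The along box extent `ZY₁` is monotone in `(q, W)`.** [this work] -/
theorem KGYRows.kgZY₁_mono_qW (H : KGYRows n ℓ hs v R' ρ q W) (hq : q ≤ q') (hW : W ≤ W') (N : ℕ) :
    kgZY₁ n ℓ hs R' ρ q N (kgM₁Y n v R' ρ W N) (kgM₂Y n ℓ hs v R' ρ q W N) ≤
      kgZY₁ n ℓ hs R' ρ q' N (kgM₁Y n v R' ρ W' N) (kgM₂Y n ℓ hs v R' ρ q' W' N) := by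
  have hm₁ : ((kgM₁Y n v R' ρ W N : ℕ) : ℤ) ≤ (kgM₁Y n v R' ρ W' N : ℕ) := by exact_mod_cast H.kgM₁Y_monoW hW N
  have hm₂ : ((kgM₂Y n ℓ hs v R' ρ q W N : ℕ) : ℤ) ≤ (kgM₂Y n ℓ hs v R' ρ q' W' N : ℕ) := by exact_mod_cast H.kgM₂Y_mono_qW hq hW N
  unfold kgZY₁
  have hq' : (q : ℤ) ≤ q' := by exact_mod_cast hq
  have hR : (0 : ℤ) ≤ R' := by positivity
  have hρ : (0 : ℤ) ≤ ρ := by positivity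
  nlinarith

end KGYMonoW

end Skelφ

end Summit.CriticalPhenomena.PercolationContinuityZ3.Theorems.Transplant
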